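import Summits.CriticalPhenomena.PercolationContinuityZ3.Theorems.PercNearOneGluingNoHeavyLowerTailIncStarTwoSepPendant
import Summits.CriticalPhenomena.PercolationContinuityZ3.Theorems.PercNearOneGluingNoHeavyLowerTailIncStarIrreducible
import HarnessLib

/-!
# The two-separation gluing theorem for the increasing star, V: THEOREM G

Support file for the Sahi programme (`--supports stmt-CriticalPhenomena-4575`, prover prim-sahi-p2 gen 23).  No definitions, no named
facts, no sorries; standard axioms.  Memo `run/shared/lean/prim/prim-sahi/FROM-prim-sahi-p2-gen22-TWO-SEPARATION-GLUING.md` §1, §3,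
`prim-sahi-p2/PROOF-E3.md` §32–§33.

**THEOREM G (two-separation gluing).**  Product Bernoulli bond percolation `prodBernoulli w` on `Fin n`, root `s`, a vertex `x ≠ s` and
a near side `L` (`s, x ∉ L`) with NO positive pair between `L` and `V ∖ (L ∪ {s, x})`; targets `a ∈ L` and `b, c ∉ L ∪ {s}`.  Let
`λ = P(Λ)`, `Λ = {∃ u ∈ L, s(s,u) open ∧ u ↔ x inside insert x L}` (the root reaches `x` through the near side).  Then

  `(∀ v, v = 1 − (1 − w(s,x))(1 − λ) → 0 ≤ E₃^{w[s(s,x) ↦ v]}({s↔x in Lᶜ}, {s↔b in Lᶜ}, {s↔c in Lᶜ}))  ⟹  0 ≤ E₃^{w}({s↔a}, {s↔b}, {s↔c})`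

(`incStar_nonneg_of_twoSep`): the increasing star for `(G; a, b, c)` follows from the increasing star of the FAR SIDE ALONE with the
root weight at `x` boosted and the near target replaced by `x` — whatever the near side looks like (cycles allowed).  Proof: the
pendant form `incStar_nonneg_of_twoSep_pendant` of `…IncStarTwoSepPendant` (three-ray identity + Harris four times) reduces to the
pendant realisation `w*`; under `w*` the pair `(x, a)` is a.s. open, so `{s↔a} = {s↔x}`; the series reduction of gen 10 at the now
unmarked vertex `a` (`SahiSeriesReduction.sahiE_principal_seriesReduce`) merges the path `s – a – x` into the root pair at `x`
(`1 − (1 − w(s,x))(1 − λ·1)`); finally nothing leaves `Lᶜ` (`IncStarIrreducible.sahiE3_openConn_eq_openConnIn_of_no_exit`,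
`…sahiE3_openConnIn_congr_weight`).
Consequences (memo §3): the increasing star is a property of the blocks of the environment `G − s` through the root; a minimal
counterexample has a 2-connected environment (`…IncStarIrreducibleTwo`); with gen 21's apex-unicyclic theorem, STAR on every cactus
environment with arbitrary root pairs (paper level).  The targetless case (`a, b, c ∉ L`) is gen 11's blob reduction
(`SahiBlobReduction.exists_blobReduce` with terminals `s, x`).
-/

noncomputable section

namespace Summit.CriticalPhenomena.PercolationContinuityZ3.Theorems

namespace IncStar

open MeasureTheory Set Literature.Probability.Percolation Literature.Probability.LatticeModels
open scoped Classical

variable {n : ℕ}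

/-! ### THEOREM G: gluing at `{s, x}` with a boosted root weight -/

/-- **THEOREM G (two-separation gluing for the increasing star).**  Let `x ≠ s`, `s, x ∉ L`, no positive pair between `L` and
`V ∖ (L ∪ {s,x})`, `a ∈ L`, `b, c ∉ L ∪ {s}`, and `λ = P(Λ)` the probability that the root reaches `x` through the near side
(`Λ = {∃ u ∈ L, s(s,u) open ∧ u ↔ x inside insert x L}`).  If the increasing star holds for the FAR side with the root weight at `x`
boosted to `1 − (1 − w(s,x))(1 − λ)` — `0 ≤ E₃({s↔x in Lᶜ}, {s↔b in Lᶜ}, {s↔c in Lᶜ})` under `prodBernoulli (w[s(s,x) ↦ v])` — then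
`0 ≤ E₃({s↔a}, {s↔b}, {s↔c})` under `prodBernoulli w`.  No hypothesis on the near side. [this work] -/
theorem incStar_nonneg_of_twoSep (w : Sym2 (Fin n) → unitInterval) (L : Set (Fin n)) {s x a b c : Fin n}
    (hxs : x ≠ s) (hsL : s ∉ L) (hxL : x ∉ L) (haL : a ∈ L) (hbL : b ∉ L) (hbs : b ≠ s) (hcL : c ∉ L) (hcs : c ≠ s)
    (hcross : ∀ y z : Fin n, y ∈ L → z ∉ L → z ≠ s → z ≠ x → w s(y, z) = 0)
    (hfar : ∀ v : unitInterval,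
      (v : ℝ) = 1 - (1 - (w s(s, x) : ℝ))
        * (1 - (prodBernoulli w).real {ω : BondConfig (Fin n) | ∃ u ∈ L, s(s, u) ∈ ω ∧ ω ∈ openConnIn (insert x L) u x}) →
      0 ≤ sahiE3 (prodBernoulli (Function.update w s(s, x) v)) (openConnIn Lᶜ s x) (openConnIn Lᶜ s b) (openConnIn Lᶜ s c)) :
    0 ≤ sahiE3 (prodBernoulli w) (openConn s a) (openConn s b) (openConn s c) := by
  have hm : ∀ X : Set (BondConfig (Fin n)), MeasurableSet X := fun _ => MeasurableSet.of_discrete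
  have hax : a ≠ x := fun h => hxL (h ▸ haL)
  have has : a ≠ s := fun h => hsL (h ▸ haL)
  have hab : a ≠ b := fun h => hbL (h ▸ haL)
  have hac : a ≠ c := fun h => hcL (h ▸ haL)
  -- `λ`
  obtain ⟨lam, hlam⟩ : ∃ r : ℝ, r = (prodBernoulli w).real
      {ω : BondConfig (Fin n) | ∃ u ∈ L, s(s, u) ∈ ω ∧ ω ∈ openConnIn (insert x L) u x} := ⟨_, rfl⟩
  have hl0 : 0 ≤ lam := by rw [hlam]; exact measureReal_nonneg
  have hl1 : lam ≤ 1 := by rw [hlam]; exact measureReal_le_one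
  -- the pendant realisation `w*`
  obtain ⟨wS, hwS⟩ : ∃ wS : Sym2 (Fin n) → unitInterval, ∀ e, wS e =
      if (∀ v ∈ e, v ∉ L) then w e else if e = s(x, a) then 1 else if e = s(s, a) then ⟨lam, ⟨hl0, hl1⟩⟩ else 0 :=
    ⟨_, fun e => rfl⟩
  have wS_far : ∀ e : Sym2 (Fin n), (∀ v ∈ e, v ∉ L) → wS e = w e := fun e he => by rw [hwS, if_pos he]
  have touch : ∀ {y z : Fin n}, y ∈ L → ¬ (∀ v ∈ s(y, z), v ∉ L) := fun hy h => h _ (Sym2.mem_mk_left _ _) hy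
  have touch' : ∀ {y z : Fin n}, z ∈ L → ¬ (∀ v ∈ s(y, z), v ∉ L) := fun hz h => h _ (Sym2.mem_mk_right _ _) hz
  have wS_xa : wS s(x, a) = 1 := by rw [hwS, if_neg (touch' haL), if_pos rfl]
  have wS_sa : (wS s(s, a) : ℝ) = lam := by
    have hne : s(s, a) ≠ s(x, a) := by
      rw [Ne, Sym2.eq_iff]; rintro (⟨h, -⟩ | ⟨h, -⟩); exacts [hxs h.symm, has h.symm]
    rw [hwS, if_neg (touch' haL), if_neg hne, if_pos rfl]
  have wS_zero : ∀ y z : Fin n, (y ∈ L ∨ z ∈ L) → s(y, z) ≠ s(x, a) → s(y, z) ≠ s(s, a) → wS s(y, z) = 0 := by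
    intro y z hyz h1 h2
    have ht : ¬ (∀ v ∈ s(y, z), v ∉ L) := by
      rcases hyz with h | h; exacts [touch h, touch' h]
    rw [hwS, if_neg ht, if_neg h1, if_neg h2]
  have h0 : ∀ u ∈ L, u ≠ a → wS s(s, u) = 0 := by
    intro u hu hua
    refine wS_zero s u (Or.inr hu) ?_ ?_
    · rw [Ne, Sym2.eq_iff]; rintro (⟨h, -⟩ | ⟨h, -⟩); exacts [hxs h.symm, has h.symm]
    · rw [Ne, Sym2.eq_iff]; rintro (⟨-, h⟩ | ⟨h, -⟩); exacts [hua h, has h.symm]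
  have hScross : ∀ y z : Fin n, y ∈ L → z ∉ L → z ≠ s → z ≠ x → wS s(y, z) = 0 := by
    intro y z hy hz hzs hzx
    refine wS_zero y z (Or.inl hy) ?_ ?_
    · rw [Ne, Sym2.eq_iff]; rintro (⟨h, -⟩ | ⟨-, h⟩); exacts [hxL (h ▸ hy), hzx h]
    · rw [Ne, Sym2.eq_iff]; rintro (⟨h, -⟩ | ⟨-, h⟩); exacts [hsL (h ▸ hy), hzs h]
  -- THEOREM G in pendant form reduces the claim to the star of `w*` at `(a, b, c)`
  refine incStar_nonneg_of_twoSep_pendant w wS L hxs hsL hxL haL hbL hbs hcL hcs hcross wS_far wS_xa h0 (wS_sa.trans hlam)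
    hScross ?_
  -- (i) under `w*` the pair `(x, a)` is a.s. open, so `{s ↔ a} = {s ↔ x}`
  set G : Set (BondConfig (Fin n)) := {ω | ∀ e, wS e = 1 → e ∈ ω}
  have hG1 : (prodBernoulli wS).real G = 1 := real_sureOpen wS
  have hA : ∀ ω ∈ G, (ω ∈ openConn s a ↔ ω ∈ openConn s x) := by
    intro ω hω
    have hadj : (openGraph ω).Adj x a := (openGraph_adj ω x a).2 ⟨hω _ wS_xa, hax.symm⟩
    exact ⟨fun h => SimpleGraph.Reachable.trans h hadj.symm.reachable, fun h => SimpleGraph.Reachable.trans h hadj.reachable⟩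
  rw [sahiE3_congr_of_sure (hm G) hG1 hA (fun _ _ => Iff.rfl) (fun _ _ => Iff.rfl)]
  -- (ii) series reduction at the (now unmarked) vertex `a`: `w*` becomes `w⁺`
  have hp0 := (w s(s, x)).2.1
  have hp1 := (w s(s, x)).2.2
  have hv : (1 : ℝ) - (1 - w s(s, x)) * (1 - lam) ∈ unitInterval := by
    constructor <;> nlinarith [mul_nonneg (sub_nonneg.2 hp1) (sub_nonneg.2 hl1)]
  obtain ⟨wP, hwP⟩ : ∃ wP : Sym2 (Fin n) → unitInterval, ∀ e, wP e =
      if a ∈ e then 0 else if e = s(s, x) then ⟨_, hv⟩ else wS e := ⟨_, fun e => rfl⟩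
  have hw : ∀ z, z ≠ s → z ≠ x → wS s(a, z) = 0 := by
    intro z hzs hzx
    refine wS_zero a z (Or.inl haL) ?_ ?_
    · rw [Ne, Sym2.eq_iff]; rintro (⟨h, -⟩ | ⟨-, h⟩); exacts [hax h, hzx h]
    · rw [Ne, Sym2.eq_iff]; rintro (⟨h, -⟩ | ⟨-, h⟩); exacts [has h, hzs h]
  have hw'x : ∀ z, wP s(a, z) = 0 := fun z => by rw [hwP, if_pos (Sym2.mem_mk_left a z)]
  have hw'e : ∀ e, a ∉ e → e ≠ s(s, x) → wP e = wS e := fun e he hne => by rw [hwP, if_neg he, if_neg hne]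
  have hasx : a ∉ s(s, x) := by
    intro h; rcases Sym2.mem_iff.1 h with h | h; exacts [has h, hax h]
  have hwPsx : wP s(s, x) = ⟨_, hv⟩ := by rw [hwP, if_neg hasx, if_pos rfl]
  have hw'yy : (wP s(s, x) : ℝ) = 1 - (1 - wS s(s, x)) * (1 - wS s(a, s) * wS s(a, x)) := by
    have e1 : wS s(s, x) = w s(s, x) := wS_far _ fun v hv' => by
      rcases Sym2.mem_iff.1 hv' with rfl | rfl; exacts [hsL, hxL]
    have e2 : (wS s(a, s) : ℝ) = lam := by rw [Sym2.eq_swap]; exact wS_sa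
    have e3 : (wS s(a, x) : ℝ) = 1 := by rw [Sym2.eq_swap, wS_xa]; rfl
    rw [hwPsx, e1, e2, e3, mul_one]
  have hred := SahiSeriesReduction.sahiE_principal_seriesReduce wS wP (x := a) (y := s) (y' := x) (s := s)
    has hax hxs.symm has.symm hw hw'x hw'e hw'yy
  rw [IncStarIrreducible.sahiE3_openConn_eq_of_sahiE_eq wS wP (fun T hT => hred 3 T fun i haT => ?_)]
  swap
  · rcases hT i a haT with h | h | h; exacts [hax h, hab h, hac h]
  -- (iii) under `w⁺` nothing leaves `Lᶜ`, and inside `Lᶜ` the weight is `w[s(s,x) ↦ v]`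
  have hexit : ∀ y ∈ Lᶜ, ∀ z ∉ Lᶜ, wP s(y, z) = 0 := by
    intro y hy z hz
    have hzL : z ∈ L := by rwa [Set.mem_compl_iff, not_not] at hz
    by_cases haz : a ∈ s(y, z)
    · rw [hwP, if_pos haz]
    have hya : y ≠ a := fun h => haz (h ▸ Sym2.mem_mk_left y z)
    have hza : z ≠ a := fun h => haz (h ▸ Sym2.mem_mk_right y z)
    have hne : s(y, z) ≠ s(s, x) := by
      rw [Ne, Sym2.eq_iff]; rintro (⟨-, h⟩ | ⟨-, h⟩); exacts [hxL (h ▸ hzL), hsL (h ▸ hzL)]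
    rw [hw'e _ haz hne]
    refine wS_zero y z (Or.inr hzL) ?_ ?_
    · rw [Ne, Sym2.eq_iff]; rintro (⟨-, h⟩ | ⟨h, -⟩); exacts [hza h, hya h]
    · rw [Ne, Sym2.eq_iff]; rintro (⟨-, h⟩ | ⟨h, -⟩); exacts [hza h, hya h]
  have hsLc : s ∈ Lᶜ := hsL
  rw [IncStarIrreducible.sahiE3_openConn_eq_openConnIn_of_no_exit wP Lᶜ hexit hsLc x b c]
  have hagree : ∀ e : Sym2 (Fin n), ¬ e.IsDiag → (∀ z ∈ e, z ∈ Lᶜ) → wP e = Function.update w s(s, x) ⟨_, hv⟩ e := by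
    intro e _ he
    have hae : a ∉ e := fun h => he a h haL
    by_cases hesx : e = s(s, x)
    · subst hesx; rw [hwPsx, Function.update_self]
    · rw [hw'e e hae hesx, Function.update_of_ne hesx, wS_far e fun v hv' => he v hv']
  rw [IncStarIrreducible.sahiE3_openConnIn_congr_weight wP (Function.update w s(s, x) ⟨_, hv⟩) Lᶜ hagree s x b c]
  have hcoe : (((⟨_, hv⟩ : unitInterval) : unitInterval) : ℝ) = 1 - (1 - (w s(s, x) : ℝ)) * (1 - lam) := rfl
  exact hfar ⟨_, hv⟩ (hcoe.trans (by rw [hlam]))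

end IncStar

end Summit.CriticalPhenomena.PercolationContinuityZ3.Theorems
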